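import Summits.BirchSwinnertonDyer.BirchSwinnertonDyer.Theorems.EisensteinPrimesAcTwistDeformationSUR
import Literature.NumberTheory.EllipticCurves.BigRepModuleShapiroSelmerConditionsProofs
import Literature.NumberTheory.EllipticCurves.BigRepModuleShapiroH1EquivProofs
import Literature.NumberTheory.EllipticCurves.KellerYin2024.CharacterSelmerGroups
import HarnessLib

/-!
# Route `EisensteinPrimes` (rung K5), crux 2 `GoodLatticeBDPValue`, line `halves` v16, stub
# `stub_imprimCorank`, road (A): SHAPIRO DESCENT `H¹(K_Σ/K, 𝐃₁) → H¹(K_∞, M)`, `[c] ↦ [h ↦ ψ(c(h̄)(0))]`,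
# for the one-variable twist deformation `𝐃₁ = bigRep κ ρ₀` — existence, injectivity, the `Λ`-orientation
# (`T ↦ conj_γ − 1`), and Greenberg's local condition `loc_w = 0` read over `K_∞`
# (helper for stmt-BirchSwinnertonDyer-19032)

Cell `bsd-eis`, seat `bsd-line-x1-p1` LEAD g2 (D-0154 row 4); fourth file of road (A). The cell's road
(γ) built the Shapiro bridge for the TWO-variable deformation (`TwistDeformationShapiro*`, `shapiroBridgePure`);
the one-variable co-induced model `AnticyclotomicBigGaloisRep` of cell `bsd-stepL` has Shapiro's lemma on `H¹`
over `Γ_K` (`BigRepModule.exists_addEquiv_h1_shapiro`) and the local-conditions dictionary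
(`BigRepModuleShapiroLocalConditionsProofs`, `…SelmerConditionsProofs`). HERE the one-variable deformation
lives over Greenberg's `G_{K,S} = Gal(K_S/K)` (the arena of `Greenberg2016.prop263_sur_of_crk`), the target is
the `K_∞`-side group `H¹(ker κ, M)` (`subgroupH1 κ.kerSubgroup M`) of the Keller–Yin / Greenberg–Vatsal
Selmer groups, and the coefficients are moved along an equivariant `ψ : A ≃+ M`
(`ψ (ρ₀ σ̄ a) = σ • ψ a`; for the application `A = ℚ_p/ℤ_p`, `M = (F/𝒪)(θ)`, `ψ = (charModuleEquiv θ)⁻¹`):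

* §1 `exists_shapiroCocycle`, `exists_shapiroDescent` — the descent `F : H¹(G_{K,S}, 𝐃₁) →+ H¹(ker κ, M)`,
  `F[c] = [z]`, `z(h) = ψ(c(h̄)(0))` (produced as `∃ F`; `liftH1AddHom`);
* §2 `oneCocycleClass_eq_zero_of_shapiroDescent_eq_zero` — `F` is INJECTIVE (bsd-stepL's M1
  `exists_eq_bigRep_sub_of_apply_zero_eq` on the compact `G_{K,S}`, `κ̄` onto);
* §3 `shapiroDescent_X_smul` — the ORIENTATION: `F(T • ξ) = conj_γ(F ξ) − F ξ` for `κ γ = 1`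
  (`BigRepModule.rho_apply_conj_zero`), i.e. `T` acts as Keller–Yin's / Greenberg–Vatsal's `γ − 1`
  (`DatumDualData.toDual_T_smul`), with NO involution;
* §4 `conjH1_shapiroDescent_mem_awayKer_of_loc_eq_zero` — Greenberg's local condition `loc_w[c] = 0`
  (`L_w = 0`, any finite `w ∈ S`) gives local triviality of EVERY conjugate `conj_σ(F[c])` at the chosen place
  of `K_∞` above `w` (`awayKer`), via bsd-stepL's local criterion `exists_eq_bigRep_sub_comp_iff` on the compact
  `Γ_{K_w}`; `conjH1_shapiroDescent_mem_unramifiedKer_of_not_mem` — at `w ∉ S` every conjugate is unramified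
  (the inertia groups above `w` die in `G_{K,S}`).

Theorems only; no named fact, no `sorry`. HONEST FRAMING: bookkeeping for the [RH]-transport and the
quotient injection of road (A); closes nothing by itself (`--supports`). References: [SkinnerUrban2014]
Prop. 3.2.3, §3.1.2; [Greenberg2006] Thm. 3 p. 342 ("as `Λ`-modules"); [Greenberg2016Selmer] §4.3 p. 21
L19–25; [GreenbergVatsal2000] §2 pp. 16–17; [SerreGaloisCohomology1997] I §2.5, §5.1.
-/

set_option autoImplicit false
set_option linter.dupNamespace false

noncomputable section

open scoped Classical
open NumberField IsDedekindDomain Field Multiplicative PowerSeries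
open Literature.NumberTheory.EllipticCurves Literature.NumberTheory.EllipticCurves.GreenbergSelmer
  Literature.NumberTheory.EllipticCurves.GreenbergVatsal2000 Literature.NumberTheory.GaloisRepresentations
  Literature.NumberTheory.IwasawaTheory Literature.NumberTheory.IwasawaTheory.Greenberg2016
  Literature.NumberTheory.IwasawaTheory.Greenberg2006

namespace Summit.BirchSwinnertonDyer.BirchSwinnertonDyer.Theorems.AcTwistDeformation

section Descent

variable {K : Type} [Field K] [NumberField K] (S : Set (HeightOneSpectrum (𝓞 K))) {p : ℕ} [Fact p.Prime]
  {A : Type} [AddCommGroup A] [Module ℤ_[p] A] [TopologicalSpace A] [DiscreteTopology A]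
  [TopologicalSpace (PowerSeries ℤ_[p])] [IsTopologicalAddGroup (BigRepModule ℤ_[p] p A)]
  [ContinuousSMul (PowerSeries ℤ_[p]) (BigRepModule ℤ_[p] p A)]
  (hS : ∀ v : HeightOneSpectrum (𝓞 K), ((p : ℕ) : 𝓞 K) ∈ v.asIdeal → v ∈ S)
  (κ : ZpExtension K p) (ρ₀ : ContinuousRep (GaloisGroupUnramifiedOutside K S) ℤ_[p] A)
  {M : Type} [AddCommGroup M] [DistribMulAction (absoluteGaloisGroup K) M] [TopologicalSpace M]
  [DiscreteTopology M]
  (ψ : A ≃+ M) (hψ : ∀ (σ : absoluteGaloisGroup K) (a : A), ψ (ρ₀ (toUnramifiedQuot K S σ) a) = σ • ψ a)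

/-! ## §1 The descent cocycle and the class-level map -/

include hψ in
/-- **The Shapiro descent cocycle.** For a continuous crossed homomorphism `c : G_{K,S} → 𝐃₁` the map
`z(h) = ψ(c(h̄)(0))` on `ker κ ≤ Γ_K` (`h̄` the class of `h` in `G_{K,S}`) is a continuous cocycle with values
in `M` (`h̄` does not move the argument of `Λ^*`: `κ̄ h̄ = κ h = 0`). [cite: SkinnerUrban2014, Prop. 3.2.3 (proof)] -/
theorem exists_shapiroCocycle (c : contOneCocycles (bigRep (κ.liftUnramifiedOutside S hS) ρ₀).toTopRep) :
    ∃ z : contOneCocycles (discreteTopRep κ.kerSubgroup M),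
      ∀ h : κ.kerSubgroup, z.1 h = ψ ((c.1 (toUnramifiedQuot K S h) : BigRepModule ℤ_[p] p A) 0) := by
  have hc : ∀ g h : GaloisGroupUnramifiedOutside K S, (c.1 (g * h) : BigRepModule ℤ_[p] p A) =
      c.1 g + bigRep (κ.liftUnramifiedOutside S hS) ρ₀ g (c.1 h) := fun g h ↦ c.2 g h
  refine ⟨⟨⟨fun h ↦ ψ ((c.1 (toUnramifiedQuot K S h) : BigRepModule ℤ_[p] p A) 0), ?_⟩, ?_⟩, fun h ↦ rfl⟩
  · exact (continuous_of_discreteTopology (f := fun Φ : BigRepModule ℤ_[p] p A ↦ ψ (Φ 0))).comp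
      (c.1.continuous.comp ((continuous_toUnramifiedQuot K S).comp continuous_subtype_val))
  · intro h₁ h₂
    have hk : κ.liftUnramifiedOutside S hS (toUnramifiedQuot K S (h₁ : absoluteGaloisGroup K)) = 1 := by
      rw [ZpExtension.liftUnramifiedOutside_mk]
      exact ZpExtension.mem_kerSubgroup.1 h₁.2
    change ψ ((c.1 (toUnramifiedQuot K S ((h₁ : absoluteGaloisGroup K) * h₂)) : BigRepModule ℤ_[p] p A) 0) =
      ψ ((c.1 (toUnramifiedQuot K S h₁) : BigRepModule ℤ_[p] p A) 0) +
        (h₁ : absoluteGaloisGroup K) • ψ ((c.1 (toUnramifiedQuot K S h₂) : BigRepModule ℤ_[p] p A) 0)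
    rw [map_mul, BigRepModule.apply_zero_cocycle (κ.liftUnramifiedOutside S hS) ρ₀ hc hk, map_add, hψ]

include hψ in
/-- **The Shapiro descent `F : H¹(K_Σ/K, 𝐃₁) → H¹(K_∞, M)`, `F[c] = [h ↦ ψ(c(h̄)(0))]`** (class level; produced as
`∃ F`): the cocycle-level map kills coboundaries (`g·Φ − Φ ↦` the coboundary of `ψ(Φ(0))`) and descends by
the universal property of `H¹` on explicit cocycles (`liftH1AddHom`). [cite: SkinnerUrban2014, Prop. 3.2.3]
[cite: Greenberg2006, Thm. 3 p. 342] -/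
theorem exists_shapiroDescent :
    ∃ F : (bigRep (κ.liftUnramifiedOutside S hS) ρ₀).H 1 →+ subgroupH1 κ.kerSubgroup M,
      ∀ (c : contOneCocycles (bigRep (κ.liftUnramifiedOutside S hS) ρ₀).toTopRep)
        (z : contOneCocycles (discreteTopRep κ.kerSubgroup M)),
        (∀ h : κ.kerSubgroup, z.1 h = ψ ((c.1 (toUnramifiedQuot K S h) : BigRepModule ℤ_[p] p A) 0)) →
        F (oneCocycleClass _ c) = oneCocycleClass _ z := by
  classical
  let X : TopRep (PowerSeries ℤ_[p]) (GaloisGroupUnramifiedOutside K S) :=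
    (bigRep (κ.liftUnramifiedOutside S hS) ρ₀).toTopRep
  let Y : TopRep ℤ κ.kerSubgroup := discreteTopRep κ.kerSubgroup M
  -- a CHOSEN descent cocycle for every `c`, additive because determined by its values
  choose sh hsh using fun c : contOneCocycles X ↦ exists_shapiroCocycle S hS κ ρ₀ ψ hψ c
  have hsh_add : ∀ c c' : contOneCocycles X, sh (c + c') = sh c + sh c' := fun c c' ↦ by
    apply Subtype.ext; apply ContinuousMap.ext; intro h
    change (sh (c + c')).1 h = (sh c).1 h + (sh c').1 h
    rw [hsh, hsh, hsh]
    change ψ (((c.1 + c'.1) (toUnramifiedQuot K S h) : BigRepModule ℤ_[p] p A) 0) = _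
    rw [ContinuousMap.add_apply, BigRepModule.add_apply, map_add]
  let shHom : contOneCocycles X →+ contOneCocycles Y :=
    { toFun := sh
      map_zero' := by
        have h0 : sh 0 + sh 0 = sh 0 := by rw [← hsh_add, add_zero]
        simpa using h0
      map_add' := hsh_add }
  have hdesc : ∀ c : contOneCocycles X, oneCocycleClass X c = 0 →
      ((oneCocycleClassₗ Y).toAddMonoidHom.comp shHom) c = 0 := by
    intro c hc
    obtain ⟨Φ, hΦ⟩ := (oneCocycleClass_eq_zero_iff X c).1 hc
    change oneCocycleClass Y (sh c) = 0
    rw [oneCocycleClass_eq_zero_iff]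
    refine ⟨ψ ((Φ : BigRepModule ℤ_[p] p A) 0), fun h ↦ ?_⟩
    have hk : κ.liftUnramifiedOutside S hS (toUnramifiedQuot K S (h : absoluteGaloisGroup K)) = 1 := by
      rw [ZpExtension.liftUnramifiedOutside_mk]
      exact ZpExtension.mem_kerSubgroup.1 h.2
    rw [hsh, hΦ]
    change ψ ((bigRep (κ.liftUnramifiedOutside S hS) ρ₀ (toUnramifiedQuot K S h) Φ - Φ) 0) =
      (h : absoluteGaloisGroup K) • ψ ((Φ : BigRepModule ℤ_[p] p A) 0) - ψ ((Φ : BigRepModule ℤ_[p] p A) 0)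
    rw [BigRepModule.bigRep_sub_apply_zero (κ.liftUnramifiedOutside S hS) ρ₀ Φ hk, map_sub, hψ]
  refine ⟨liftH1AddHom X ((oneCocycleClassₗ Y).toAddMonoidHom.comp shHom) hdesc, fun c z hz ↦ ?_⟩
  refine (liftH1AddHom_oneCocycleClass X _ hdesc c).trans ?_
  change oneCocycleClass Y (sh c) = oneCocycleClass Y z
  congr 1
  exact Subtype.ext (ContinuousMap.ext fun h ↦ by rw [hsh, hz])

/-! ## §2 Injectivity -/

include hψ in
/-- **The Shapiro descent is injective**: if `F[c] = 0` then `[c] = 0`. The Shapiro image of `c` on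
`ker κ̄ ≤ G_{K,S}` is the coboundary of `ψ⁻¹(m)` (every class of `G_{K,S}` lifts to `Γ_K`), so bsd-stepL's M1
(`exists_eq_bigRep_sub_of_apply_zero_eq`, `κ̄` onto, `G_{K,S}` compact) makes `c` a coboundary.
[cite: SkinnerUrban2014, Prop. 3.2.3 (proof)] [cite: SerreGaloisCohomology1997, I §2.5] -/
theorem oneCocycleClass_eq_zero_of_shapiroDescent_eq_zero (hA : ∀ a : A, ∃ k : ℕ, p ^ k • a = 0)
    {F : (bigRep (κ.liftUnramifiedOutside S hS) ρ₀).H 1 →+ subgroupH1 κ.kerSubgroup M}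
    (hF : ∀ (c : contOneCocycles (bigRep (κ.liftUnramifiedOutside S hS) ρ₀).toTopRep)
      (z : contOneCocycles (discreteTopRep κ.kerSubgroup M)),
      (∀ h : κ.kerSubgroup, z.1 h = ψ ((c.1 (toUnramifiedQuot K S h) : BigRepModule ℤ_[p] p A) 0)) →
      F (oneCocycleClass _ c) = oneCocycleClass _ z)
    (c : contOneCocycles (bigRep (κ.liftUnramifiedOutside S hS) ρ₀).toTopRep)
    (h0 : F (oneCocycleClass _ c) = 0) : oneCocycleClass _ c = 0 := by
  obtain ⟨z, hz⟩ := exists_shapiroCocycle S hS κ ρ₀ ψ hψ c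
  rw [hF c z hz, oneCocycleClass_eq_zero_iff] at h0
  obtain ⟨m, hm⟩ := h0
  have hc : ∀ g h : GaloisGroupUnramifiedOutside K S, (c.1 (g * h) : BigRepModule ℤ_[p] p A) =
      c.1 g + bigRep (κ.liftUnramifiedOutside S hS) ρ₀ g (c.1 h) := fun g h ↦ c.2 g h
  have hSh : ∀ g : GaloisGroupUnramifiedOutside K S, κ.liftUnramifiedOutside S hS g = 1 →
      (c.1 g : BigRepModule ℤ_[p] p A) 0 = ρ₀ g (ψ.symm m) - ψ.symm m := by
    intro g hg
    obtain ⟨σ, rfl⟩ := toUnramifiedQuot_surjective K S g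
    have hσ : σ ∈ κ.kerSubgroup := ZpExtension.mem_kerSubgroup.2 hg
    apply ψ.injective
    have h1 := hm ⟨σ, hσ⟩
    rw [hz] at h1
    change ψ ((c.1 (toUnramifiedQuot K S σ) : BigRepModule ℤ_[p] p A) 0) = σ • m - m at h1
    rw [h1, map_sub, hψ, ψ.apply_symm_apply]
  obtain ⟨Φ, -, hΦ⟩ := BigRepModule.exists_eq_bigRep_sub_of_apply_zero_eq
    (κ := κ.liftUnramifiedOutside S hS) (ρ := ρ₀) (κ.liftUnramifiedOutside_surjective S hS) hA
    c.1.continuous hc hSh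
  rw [oneCocycleClass_eq_zero_iff]
  exact ⟨Φ, fun g ↦ hΦ g⟩

/-! ## §3 The orientation: `T` acts as `conj_γ − 1` -/

omit [NumberField K] in
/-- `conj_σ` on an explicit cocycle of `H¹(H, N)`: `conj_σ [z] = [x ↦ σ • z(σ⁻¹ x σ)]` (Mathlib
`map_oneCocycleClass`; the tree's `conjH1` is a `resH1Hom`). [cite: SerreGaloisCohomology1997, I §5.1 and I §2.5] -/
theorem conjH1_oneCocycleClass_eq {H : Subgroup (absoluteGaloisGroup K)} [H.Normal] (σ : absoluteGaloisGroup K)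
    (z : contOneCocycles (discreteTopRep H M)) :
    conjH1 H M σ (oneCocycleClass _ z) =
      oneCocycleClass (discreteTopRep H M) (contOneCocycles.pullback (subgroupConj H σ)
        (resHomOfEquivariant (subgroupConj H σ) (DistribSMul.toAddMonoidHom M σ) fun x m ↦ by
          simp only [DistribSMul.toAddMonoidHom_apply, Subgroup.smul_def, subgroupConj_apply_coe,
            smul_smul, mul_assoc, mul_inv_cancel_left]) z) :=
  map_oneCocycleClass (X := discreteTopRep H M) (Y := discreteTopRep H M) _ _ z

omit [NumberField K] in
/-- `res_{(φ, χ)} [f] = [χ ∘ f ∘ φ]` on explicit cocycles (Mathlib `map_oneCocycleClass`; the tree's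
`resH1Hom`). [cite: SerreGaloisCohomology1997, I §2.4] -/
theorem resH1Hom_oneCocycleClass_eq' {H : Subgroup (absoluteGaloisGroup K)} {G' : Type}
    [Group G'] [TopologicalSpace G'] [IsTopologicalGroup G'] {N' : Type} [AddCommGroup N']
    [DistribMulAction G' N'] [TopologicalSpace N'] [DiscreteTopology N'] (φ : G' →ₜ* H) (χ : M →+ N')
    (h : ∀ (x : G') (m : M), χ (φ x • m) = x • χ m) (f : contOneCocycles (discreteTopRep H M)) :
    resH1Hom φ χ h (oneCocycleClass (discreteTopRep H M) f) =
      oneCocycleClass (discreteTopRep G' N') (contOneCocycles.pullback φ (resHomOfEquivariant φ χ h) f) :=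
  map_oneCocycleClass (X := discreteTopRep H M) (Y := discreteTopRep G' N') φ (resHomOfEquivariant φ χ h) f

include hψ in
/-- **ORIENTATION of the Shapiro descent: `F((1 + T) • ξ) = conj_γ (F ξ)`, i.e. `F(T • ξ) = conj_γ(F ξ) − F ξ`
for a topological generator `γ` (`κ γ = 1`).** On cocycles: `((1+T) • c)(h̄)(0) = c(h̄)(1)`, while
`γ • ψ(c(γ̄⁻¹h̄γ̄)(0)) = ψ(c(h̄)(κ γ)) + (h • b − b)` (`rho_apply_conj_zero`). So under `F` the coefficient action of
`T ∈ Λ` on `H¹(K_Σ/K, 𝐃₁)` becomes EXACTLY the action `conj_γ − 1` through which Greenberg–Vatsal / Keller–Yin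
make the Pontryagin dual a `Λ`-module (`DatumDualData.toDual_T_smul`) — no involution `γ ↦ γ⁻¹` for the
convention `(g·Φ)(x) = ρ(g)Φ(x − κ g)`. [cite: Greenberg2006, Thm. 3 p. 342 ("as Λ-modules")]
[cite: SkinnerUrban2014, §3.1.2 ((3.1.2.a)) and Prop. 3.2.3] -/
theorem shapiroDescent_X_smul
    {F : (bigRep (κ.liftUnramifiedOutside S hS) ρ₀).H 1 →+ subgroupH1 κ.kerSubgroup M}
    (hF : ∀ (c : contOneCocycles (bigRep (κ.liftUnramifiedOutside S hS) ρ₀).toTopRep)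
      (z : contOneCocycles (discreteTopRep κ.kerSubgroup M)),
      (∀ h : κ.kerSubgroup, z.1 h = ψ ((c.1 (toUnramifiedQuot K S h) : BigRepModule ℤ_[p] p A) 0)) →
      F (oneCocycleClass _ c) = oneCocycleClass _ z)
    {γ : absoluteGaloisGroup K} (hγ : κ.IsTopGenerator γ)
    (ξ : (bigRep (κ.liftUnramifiedOutside S hS) ρ₀).H 1) :
    F ((PowerSeries.X : PowerSeries ℤ_[p]) • ξ) = conjH1 κ.kerSubgroup M γ (F ξ) - F ξ := by
  set X : TopRep (PowerSeries ℤ_[p]) (GaloisGroupUnramifiedOutside K S) :=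
    (bigRep (κ.liftUnramifiedOutside S hS) ρ₀).toTopRep with hX
  obtain ⟨c, rfl⟩ := oneCocycleClass_surjective X ξ
  obtain ⟨z, hz⟩ := exists_shapiroCocycle S hS κ ρ₀ ψ hψ c
  obtain ⟨z₁, hz₁⟩ := exists_shapiroCocycle S hS κ ρ₀ ψ hψ ((PowerSeries.X : PowerSeries ℤ_[p]) • c)
  have hc : ∀ g h : GaloisGroupUnramifiedOutside K S, (c.1 (g * h) : BigRepModule ℤ_[p] p A) =
      c.1 g + bigRep (κ.liftUnramifiedOutside S hS) ρ₀ g (c.1 h) := fun g h ↦ c.2 g h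
  have hγ1 : (κ.liftUnramifiedOutside S hS (toUnramifiedQuot K S γ)).toAdd = 1 := by
    rw [ZpExtension.liftUnramifiedOutside_mk, show κ γ = ofAdd 1 from hγ, toAdd_ofAdd]
  have hsmul : F ((PowerSeries.X : PowerSeries ℤ_[p]) • oneCocycleClass X c) =
      oneCocycleClass (discreteTopRep κ.kerSubgroup M) z₁ := by
    rw [← hF _ z₁ hz₁, oneCocycleClass_smul]
  refine hsmul.trans ?_
  rw [hF c z hz, conjH1_oneCocycleClass_eq, eq_sub_iff_add_eq, ← oneCocycleClass_add,
    ← sub_eq_zero, ← oneCocycleClass_sub, oneCocycleClass_eq_zero_iff]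
  -- the coboundary of `-ψ b`, `b = c(γ̄)(1)`
  refine ⟨-ψ ((c.1 (toUnramifiedQuot K S γ) : BigRepModule ℤ_[p] p A) 1), fun h ↦ ?_⟩
  have hk : κ.liftUnramifiedOutside S hS (toUnramifiedQuot K S (h : absoluteGaloisGroup K)) = 1 := by
    rw [ZpExtension.liftUnramifiedOutside_mk]
    exact ZpExtension.mem_kerSubgroup.1 h.2
  have key := BigRepModule.rho_apply_conj_zero (κ.liftUnramifiedOutside S hS) ρ₀ hc (toUnramifiedQuot K S γ) hk
  rw [hγ1] at key
  change (z₁.1 h + z.1 h) - (γ • z.1 (subgroupConj κ.kerSubgroup γ h)) =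
    (h : absoluteGaloisGroup K) • (-ψ ((c.1 (toUnramifiedQuot K S γ) : BigRepModule ℤ_[p] p A) 1)) -
      (-ψ ((c.1 (toUnramifiedQuot K S γ) : BigRepModule ℤ_[p] p A) 1))
  rw [hz₁, hz, hz]
  change ψ ((((PowerSeries.X : PowerSeries ℤ_[p]) • c.1 (toUnramifiedQuot K S h)) : BigRepModule ℤ_[p] p A) 0) +
      ψ ((c.1 (toUnramifiedQuot K S h) : BigRepModule ℤ_[p] p A) 0) -
      γ • ψ ((c.1 (toUnramifiedQuot K S (γ⁻¹ * h * γ)) : BigRepModule ℤ_[p] p A) 0) = _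
  have hq : toUnramifiedQuot K S (γ⁻¹ * (h : absoluteGaloisGroup K) * γ) =
      (toUnramifiedQuot K S γ)⁻¹ * toUnramifiedQuot K S (h : absoluteGaloisGroup K) * toUnramifiedQuot K S γ := by
    rw [map_mul, map_mul, map_inv]
  rw [BigRepModule.X_smul_apply, zero_add, map_sub, sub_add_cancel, ← hψ, hq, key, map_add, map_sub, hψ,
    smul_neg, sub_neg_eq_add]
  abel

/-! ## §4 Greenberg's local condition `loc_w = 0` read over `K_∞` -/

/-- `loc_w` on an explicit crossed homomorphism: the localisation of `[c]` at the place `w` VANISHES iff `c`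
restricted to `Γ_{K_w}` (through `Γ_{K_w} → G_{K,S}`) is principal in `𝐃₁`.
[cite: Greenberg2016Selmer, §1 p. 3 L26–28] [cite: SerreGaloisCohomology1997, Ch. I §5.1] -/
theorem loc_bigRep_oneCocycleClass_eq_zero_iff [IsTopologicalRing (PowerSeries ℤ_[p])] (w : Place K)
    (c : contOneCocycles (bigRep (κ.liftUnramifiedOutside S hS) ρ₀).toTopRep) :
    loc S (bigRep (κ.liftUnramifiedOutside S hS) ρ₀) w 1
        (oneCocycleClass (bigRep (κ.liftUnramifiedOutside S hS) ρ₀).toTopRep c) = 0 ↔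
      ∃ Φ : BigRepModule ℤ_[p] p A, ∀ τ : absoluteGaloisGroup w.Completion,
        c.1 (localToUnramified S w τ) =
          bigRep (κ.liftUnramifiedOutside S hS) ρ₀ (localToUnramified S w τ) Φ - Φ := by
  change (ContinuousCohomology.map (localToUnramified S w)
      (X := (bigRep (κ.liftUnramifiedOutside S hS) ρ₀).toTopRep)
      (Y := ((bigRep (κ.liftUnramifiedOutside S hS) ρ₀).restrict (localToUnramified S w)).toTopRep)
      (TopRep.ofHom ⟨ContinuousLinearMap.id _ _, fun _ ↦ rfl⟩) 1).hom
      (oneCocycleClass (bigRep (κ.liftUnramifiedOutside S hS) ρ₀).toTopRep c) = 0 ↔ _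
  rw [map_oneCocycleClass, oneCocycleClass_eq_zero_iff]
  rfl

include hψ in
/-- **`loc_w[c] = 0` ⇒ every conjugate of the Shapiro class is LOCALLY TRIVIAL above `w` over `K_∞`.** For a
finite place `w` and a continuous crossed homomorphism `c : G_{K,S} → 𝐃₁` whose localisation at `w` vanishes
(Greenberg's condition `L_w = 0`), every `conj_σ(F[c])`, `σ ∈ Γ_K`, dies on `ker κ ⊓ D_w` (`awayKer`, the
chosen place of `K_∞` above `w` — all of them as `σ` varies): bsd-stepL's local criterion
`exists_eq_bigRep_sub_comp_iff` on the compact `Γ_{K_w}` turns the principal `c|_{Γ_{K_w}}` into principal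
EVALUATIONS `τ ↦ c(τ̄)(x)` on the `τ` over `ker κ`, and `conj_σ(Sh c) ∼ ev_{κ σ}(c)` (`rho_apply_conj_zero`).
[cite: SkinnerUrban2014, §3.1.2 ((3.1.2.a)–(3.1.2.b)) and Prop. 3.2.3] [cite: GreenbergVatsal2000, §2 p. 17] -/
theorem conjH1_shapiroDescent_mem_awayKer_of_loc_eq_zero [IsTopologicalRing (PowerSeries ℤ_[p])]
    (hA : ∀ a : A, ∃ k : ℕ, p ^ k • a = 0)
    {F : (bigRep (κ.liftUnramifiedOutside S hS) ρ₀).H 1 →+ subgroupH1 κ.kerSubgroup M}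
    (hF : ∀ (c : contOneCocycles (bigRep (κ.liftUnramifiedOutside S hS) ρ₀).toTopRep)
      (z : contOneCocycles (discreteTopRep κ.kerSubgroup M)),
      (∀ h : κ.kerSubgroup, z.1 h = ψ ((c.1 (toUnramifiedQuot K S h) : BigRepModule ℤ_[p] p A) 0)) →
      F (oneCocycleClass _ c) = oneCocycleClass _ z)
    (w : HeightOneSpectrum (𝓞 K)) (c : contOneCocycles (bigRep (κ.liftUnramifiedOutside S hS) ρ₀).toTopRep)
    (hloc : loc S (bigRep (κ.liftUnramifiedOutside S hS) ρ₀) (Sum.inr w) 1 (oneCocycleClass _ c) = 0)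
    (σ : absoluteGaloisGroup K) :
    conjH1 κ.kerSubgroup M σ (F (oneCocycleClass _ c)) ∈ awayKer κ.kerSubgroup M w := by
  haveI : CompactSpace (absoluteGaloisGroup (Place.Completion (Sum.inr w : Place K))) :=
    absoluteGaloisGroup_compactSpace _
  obtain ⟨z, hz⟩ := exists_shapiroCocycle S hS κ ρ₀ ψ hψ c
  have hc : ∀ g h : GaloisGroupUnramifiedOutside K S, (c.1 (g * h) : BigRepModule ℤ_[p] p A) =
      c.1 g + bigRep (κ.liftUnramifiedOutside S hS) ρ₀ g (c.1 h) := fun g h ↦ c.2 g h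
  -- `loc_w[c] = 0`: all evaluations are principal on the `τ` over `ker κ`
  have hev := (BigRepModule.exists_eq_bigRep_sub_comp_iff (κ.liftUnramifiedOutside S hS) ρ₀
    (localToUnramified S (Sum.inr w : Place K)) hA c.1.continuous hc).1
    ((loc_bigRep_oneCocycleClass_eq_zero_iff S hS κ ρ₀ (Sum.inr w) c).1 hloc)
  rw [hF c z hz, awayKer, AddMonoidHom.mem_ker,
    Literature.NumberTheory.EllipticCurves.BigGaloisRep.resOfLe_conjH1_oneCocycleClass_eq_zero_iff]
  obtain ⟨a, ha⟩ := hev (κ σ).toAdd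
  refine ⟨ψ (a + (c.1 (toUnramifiedQuot K S σ) : BigRepModule ℤ_[p] p A) (κ σ).toAdd), fun x ↦ ?_⟩
  have hxH : κ.liftUnramifiedOutside S hS (toUnramifiedQuot K S (x : absoluteGaloisGroup K)) = 1 := by
    rw [ZpExtension.liftUnramifiedOutside_mk]
    exact ZpExtension.mem_kerSubgroup.1 (Subgroup.mem_inf.1 x.2).1
  obtain ⟨τ, hτ⟩ := (mem_decomp_iff w _).1 (Subgroup.mem_inf.1 x.2).2
  have hτ' : localToUnramified S (Sum.inr w : Place K) τ = toUnramifiedQuot K S (x : absoluteGaloisGroup K) := by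
    rw [← hτ]; rfl
  have hax := ha τ (by rw [hτ']; exact hxH)
  rw [hτ'] at hax
  have key := BigRepModule.rho_apply_conj_zero (κ.liftUnramifiedOutside S hS) ρ₀ hc (toUnramifiedQuot K S σ) hxH
  rw [ZpExtension.liftUnramifiedOutside_mk] at key
  have hq : toUnramifiedQuot K S (σ⁻¹ * (x : absoluteGaloisGroup K) * σ) =
      (toUnramifiedQuot K S σ)⁻¹ * toUnramifiedQuot K S (x : absoluteGaloisGroup K) * toUnramifiedQuot K S σ := by
    rw [map_mul, map_mul, map_inv]
  simp only [hz, subgroupConj_apply_coe, subgroupInclusion_apply_coe]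
  rw [← hψ, hq, key, hax, ← hψ, ← map_sub ψ]
  congr 1
  rw [map_add]
  abel

include hψ in
/-- **At a finite place `w ∉ S` every conjugate of the Shapiro class is UNRAMIFIED**: the inertia groups of
`Γ_K` above `w` lie in `N_S = ker(Γ_K ↠ G_{K,S})` (`inertia_le_ramificationSubgroup`), so the conjugated descent
cocycle vanishes identically on `ker κ ⊓ I_w`. [cite: GreenbergVatsal2000, §2 pp. 16–17 (H¹(ℚ_Σ/ℚ_∞, A): classes unramified outside Σ)]
[cite: NeukirchSchmidtWingberg2008, VIII §3] -/
theorem conjH1_shapiroDescent_mem_unramifiedKer_of_not_mem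
    {F : (bigRep (κ.liftUnramifiedOutside S hS) ρ₀).H 1 →+ subgroupH1 κ.kerSubgroup M}
    (hF : ∀ (c : contOneCocycles (bigRep (κ.liftUnramifiedOutside S hS) ρ₀).toTopRep)
      (z : contOneCocycles (discreteTopRep κ.kerSubgroup M)),
      (∀ h : κ.kerSubgroup, z.1 h = ψ ((c.1 (toUnramifiedQuot K S h) : BigRepModule ℤ_[p] p A) 0)) →
      F (oneCocycleClass _ c) = oneCocycleClass _ z)
    {w : HeightOneSpectrum (𝓞 K)} (hw : w ∉ S)
    (c : contOneCocycles (bigRep (κ.liftUnramifiedOutside S hS) ρ₀).toTopRep) (σ : absoluteGaloisGroup K) :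
    conjH1 κ.kerSubgroup M σ (F (oneCocycleClass _ c)) ∈ GreenbergVatsal2000.unramifiedKer κ.kerSubgroup M w := by
  obtain ⟨z, hz⟩ := exists_shapiroCocycle S hS κ ρ₀ ψ hψ c
  have hc : ∀ g h : GaloisGroupUnramifiedOutside K S, (c.1 (g * h) : BigRepModule ℤ_[p] p A) =
      c.1 g + bigRep (κ.liftUnramifiedOutside S hS) ρ₀ g (c.1 h) := fun g h ↦ c.2 g h
  have h1 : (c.1 1 : BigRepModule ℤ_[p] p A) = 0 := by
    have := hc 1 1
    rwa [mul_one, map_one (bigRep (κ.liftUnramifiedOutside S hS) ρ₀), Module.End.one_apply,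
      left_eq_add] at this
  rw [hF c z hz, GreenbergVatsal2000.unramifiedKer, AddMonoidHom.mem_ker, conjH1_oneCocycleClass_eq,
    resH1Hom_oneCocycleClass_eq', oneCocycleClass_eq_zero_iff]
  refine ⟨0, fun x ↦ ?_⟩
  have hxI : ((x : decomp (K := K) w) : absoluteGaloisGroup K) ∈ inertia w := ((mem_inertiaIn_iff _ w _).1 x.2).2
  -- `σ⁻¹ x σ ∈ N_S`
  have hmem : σ⁻¹ * ((x : decomp (K := K) w) : absoluteGaloisGroup K) * σ ∈ ramificationSubgroup K S := by
    have hI : ((x : decomp (K := K) w) : absoluteGaloisGroup K) ∈ ramificationSubgroup K S := by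
      refine inertia_le_ramificationSubgroup hw (adicCompletionPrime_mem_primesAbove K w) ?_
      rw [inertia_adicCompletionPrime_eq_map_absInertia]
      exact hxI
    have := (ramificationSubgroup_normal K S).conj_mem _ hI σ⁻¹
    rwa [inv_inv] at this
  have hquot : toUnramifiedQuot K S (σ⁻¹ * ((x : decomp (K := K) w) : absoluteGaloisGroup K) * σ) = 1 :=
    (QuotientGroup.eq_one_iff _).mpr hmem
  rw [map_zero, sub_zero]
  change σ • z.1 (subgroupConj κ.kerSubgroup σ (inertiaInToH κ.kerSubgroup w x)) = 0
  rw [hz]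
  change σ • ψ ((c.1 (toUnramifiedQuot K S (σ⁻¹ * ((x : decomp (K := K) w) : absoluteGaloisGroup K) * σ)) :
    BigRepModule ℤ_[p] p A) 0) = 0
  rw [hquot, h1, BigRepModule.zero_apply, map_zero, smul_zero]

end Descent

end Summit.BirchSwinnertonDyer.BirchSwinnertonDyer.Theorems.AcTwistDeformation

end
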